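import Literature.Computability.Complexity.MurrayWilliams2018NQP
import Literature.Computability.Complexity.QuasiPolyClock
import HarnessLib

/-!
# Murray–Williams' `NQP ⊄ ACC⁰` at every quasi-polynomial level: pinning at size `n^{logᵏ n}`

`MurrayWilliams2018NQP.lean` proves the headline `¬ (NQP ⊆ ACC0)`
(`MurrayWilliams2018_NQP_not_subset_ACC0`) from the printed Theorem 1.3 of Murray–Williams
(STOC 2018) — the `(k, d, m)`-indexed named facts `MurrayWilliams2018_thm_1_2_acc`,
`MurrayWilliams2018_thm_5_1` of `MurrayWilliams2018.lean` — by Williams' PINNING device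
(J. ACM 2014, Lemma 5.1: the `ACC` circuits of the single polynomial-time problem CIRCUIT-EVAL
put every small circuit family into ONE `AC⁰_d[m]`), carried out there at polynomial size
(`exists_pinned_of_P_subset_ACC0`). This file carries the same device out at QUASI-POLYNOMIAL
size and thereby PROVES, from the same three components, the §1.1 form
`Literature.Computability.Complexity.MurrayWilliams2018_NQP_not_ACC` of `CircuitLowerBounds.lean`
("`NQP` does not have `ACC ∘ THR` circuits of `n^{logᵏ n}` size, for all fixed `k`": for every
`k` ONE language of `NQP` that, for no depth `d`, modulus `m ≥ 2` and constant `c`, has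
depth-`d` `AC⁰[m]` circuit families of size `c · n^{(log₂ n)ᵏ} + c`):

* `mem_depthSizeClass_of_evalLang_mem` — **pinning, size-generic** (Williams 2014, Lemma 5.1,
  the construction of its proof): if `CircEval.EvalLang` (`CircuitEval.lean`) has depth-`d`
  `AC⁰[m]` circuits of a monotone size bound `q`, then every language with `B₂` circuits of size
  `s` has depth-`(d + 1)` `AC⁰[m]` circuits of size `q(2n + 2 + (s n + 1)(8(n + s n) + 10)) + 2`
  (hard-wire the description `desc Cₙ`, `Circuit.exists_hardwire`; the proof of
  `exists_pinned_of_P_subset_ACC0` verbatim with functions in place of polynomials);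
* `mem_SIZE_of_mem_depthSizeClass_accBasis` — `AC⁰[m]` circuits with `S n` gates are `B₂`
  circuits with `1 + S n · accGateCost m (n + S n)` gates (`Circuit.exists_B2_of_accBasis`,
  `ACC0SubsetPPoly.lean`);
* the growth bookkeeping of "quasi-polynomial of level `j`" (`f n ≤ 2^{a (log₂ n + 2)ʲ}` for
  some `a`, kept as plain `∃ a, ∀ n` statements): closed under `+`, `·` (`qpoly_add`,
  `qpoly_mul`), contains `n` and the constants, `N ↦ N^{(log₂ N)ᵏ}` raises the level from `j` to
  `j (k + 1)` (`qpoly_powLog`), and every such `f` is `≤ c · 2^{(log₂ n)^{j+1}} + c`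
  (`qpoly_exists_le_two_pow_log_pow`);
* `exists_level_pinned` — **proved**: for every `k` there is a level `K` such that, whenever
  `EvalLang` has depth-`d₀` `AC⁰[m₀]` circuits of size `c₀ · n^{(log₂ n)ᵏ} + c₀`, every language
  with `AC⁰[m]` circuits (any `m ≥ 1`, any depth) of size `c · n^{(log₂ n)ᵏ} + c` has
  depth-`(d₀ + 1)` `AC⁰[m₀]` circuits of size `c' · 2^{(log₂ n)ᴷ} + c'`;
* `MurrayWilliams2018_NQP_not_ACC_of_components` — **proved**: `MurrayWilliams2018_thm_1_2_acc`,
  `MurrayWilliams2018_thm_5_1` and the glue fact `NTIME_powLog_subset_NQP`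
  (`MurrayWilliams2018NQP.lean`) imply `MurrayWilliams2018_NQP_not_ACC`: if every `NQP`
  language had level-`k` `AC⁰` circuits for its own `(d, m)`, then so would
  `EvalLang ∈ P ⊆ NQP` (`P_subset_NQP`) for one `(d₀, m₀)`, hence (pinning) all of `NQP` would
  have depth-`(d₀ + 1)` `AC⁰[m₀]` circuits of level `K`, contradicting Thm. 1.2/5.1 at
  `(d₀ + 1, m₀, K)`, whose hard language lies in `NTIME(n^{(log₂ n)ᵉ}) ⊆ NQP`;
* `MurrayWilliams2018_NQP_not_ACC_of_thm_1_2_acc` — **proved**: the same from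
  `MurrayWilliams2018_thm_1_2_acc` and `MurrayWilliams2018_thm_5_1` ALONE, the glue inclusion
  being the theorem `NTIME_pow_log_pow_subset_NQP` of `QuasiPolyClock.lean` (the quasi-polynomial
  witness clock: `NTIME (n ^ (log₂ n) ^ e) ⊆ NTIME (2 ^ (log₂ n) ^ (e + 2)) ⊆ NQP`); and
  `MurrayWilliams2018_NQP_not_subset_ACC0_of_thm_1_2_acc`, the headline `¬ (NQP ⊆ ACC0)` from the
  same two facts.

So the trust base of the §1.1 form is that of the headline, and after `QuasiPolyClock.lean` it is
`{MurrayWilliams2018_thm_1_2_acc, MurrayWilliams2018_thm_5_1}` — the two theorems the source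
quotes on p. 15 (Thm. 1.2, proved in §3–§5 there from the easy witness lemma for `NQP`, the PCP of
Ben-Sasson–Viola and the nondeterministic time hierarchy; Thm. 5.1 = Williams' `ACC`-SAT
algorithm); the corollary `MurrayWilliams2018_NQP_not_ACC.not_subset_ACC0`
(`CircuitLowerBounds.lean`) recovers the headline once more.

## References

* C. D. Murray, R. R. Williams, *Circuit lower bounds for nondeterministic quasi-polytime: an easy
  witness lemma for NP and NQP*, STOC 2018, 890–901 (ECCC TR17-188), §1.1, Thm. 1.3, §5 (proof
  of Thm. 1.1: the `C`-circuits of EVAL-GATE) [MurrayWilliams2018].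
* R. Williams, *Nonuniform ACC circuit lower bounds*, J. ACM 61 (2014), Lemma 5.1 ("If `P` has
  non-uniform `C` circuits of `S(n)^{O(1)}` size, then … every `T(n)`-size circuit family … has an
  equivalent `S(n + O(T(n) log T(n)))ᶜ`-size circuit family in `C`") [Williams2014].
* S. Arora, B. Barak, *Computational Complexity: A Modern Approach*, CUP 2009, Thm. 6.18 (circuit
  evaluation with the description as advice) [AroraBarak2009].
-/

namespace Literature.Computability.Complexity

open Classes CircEval

/-! ### Pinning with arbitrary size bounds -/

/-- **Pinning, size-generic** (Williams 2014, Lemma 5.1, the construction of its proof; the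
polynomial case is `exists_pinned_of_P_subset_ACC0`). If the circuit-evaluation language
`EvalLang` has depth-`d` `AC⁰[m]` circuits of a monotone size bound `q`, then every language `L`
decided by `B₂` circuits of size `s n` has depth-`(d + 1)` `AC⁰[m]` circuits of size
`q (2n + 2 + (s n + 1)(8(n + s n) + 10)) + 2`: hard-wire the description `desc Cₙ`
(`|desc Cₙ| ≤ (|Cₙ| + 1)(8(n + |Cₙ|) + 10)`, `CircEval.length_desc_le`) into the circuit of
`EvalLang` for pairs `⟨x, desc Cₙ⟩` (`Circuit.exists_hardwire`: two more gates, one more level).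
[cite: Williams2014, Lemma 5.1] -/
theorem mem_depthSizeClass_of_evalLang_mem {m d : ℕ} {q : ℕ → ℕ} (hq : Monotone q)
    (hE : EvalLang ∈ DepthSizeClass (accBasis m) (fun _ => d) q) {L : Language Bool}
    {s : ℕ → ℕ} (hL : L ∈ SIZE s) :
    L ∈ DepthSizeClass (accBasis m) (fun _ => d + 1)
      (fun n => q (2 * n + 2 + (s n + 1) * (8 * (n + s n) + 10)) + 2) := by
  classical
  obtain ⟨C, hC, hdec⟩ := hE
  obtain ⟨F, hF, hFdec⟩ := hL
  have har : ∀ n, ∀ g ∈ (F n).gates, g.arity ≤ 2 := fun n g hg => (hF n).1 g hg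
  -- the advice: the description of the `n`-th circuit
  let a : ℕ → List Bool := fun n => desc (F n)
  have hpa : ∀ n, (a n).length ≤ (s n + 1) * (8 * (n + s n) + 10) := by
    intro n
    refine (length_desc_le (F n)).trans ?_
    have hs : (F n).size ≤ s n := (hF n).2
    exact Nat.mul_le_mul (by omega) (by omega)
  have hLa : ∀ x, x ∈ L ↔ boolPair x (a x.length) ∈ EvalLang := by
    intro x
    change x ∈ L ↔ evalFn (boolPair x (desc (F x.length))) = [true]
    rw [evalFn_boolPair_desc x (F x.length) (har x.length), hFdec x, List.cons.injEq]
    simp only [and_true]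
    exact Set.mem_iff_boolIndicator L x
  -- hard-wiring the advice into the circuits of `EvalLang`
  have main : ∀ n : ℕ, ∃ D : Circuit (Fin n), D.IsOver (accBasis m) ∧ D.acDepth ≤ d + 1 ∧
      D.size ≤ q (2 * n + 2 + (s n + 1) * (8 * (n + s n) + 10)) + 2 ∧
        ∀ u : Fin n → Bool, D.eval u = L.boolIndicator (List.ofFn u) := by
    intro n
    let σ : Fin (2 * n + 2 + (a n).length) → Fin n ⊕ Bool :=
      Fin.append (Fin.append (fun i : Fin (2 * n) => Sum.inl ⟨(i : ℕ) / 2, by have := i.2; omega⟩)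
        ![Sum.inr false, Sum.inr true]) (fun j => Sum.inr ((a n).get j))
    obtain ⟨D, hDB, hDs, hDd, hDe⟩ := Circuit.exists_hardwire (B := accBasis m)
      (acBasis_subset_accBasis m (or_mem_acBasis 0)) (acBasis_subset_accBasis m (and_mem_acBasis 0))
      (C (2 * n + 2 + (a n).length)) (hC _).1 σ
    refine ⟨D, hDB, hDd.trans (Nat.add_le_add_right (hC (2 * n + 2 + (a n).length)).2.1 1),
      hDs.trans ?_, fun u => ?_⟩
    · have h1 : 2 * n + 2 + (a n).length ≤ 2 * n + 2 + (s n + 1) * (8 * (n + s n) + 10) := by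
        have := hpa n; omega
      have h2 := hq h1
      have h3 : (C (2 * n + 2 + (a n).length)).size ≤ q (2 * n + 2 + (a n).length) :=
        (hC (2 * n + 2 + (a n).length)).2.2
      omega
    · rw [hDe u]
      have hσ : (fun j => Sum.elim u id (σ j)) = pairVec u (a n).get := by
        funext j
        refine Fin.addCases (fun j₁ => ?_) (fun j₂ => ?_) j
        · refine Fin.addCases (fun i => ?_) (fun t => ?_) j₁
          · simp [σ, pairVec, Fin.append_left]
          · simp only [σ, pairVec, Fin.append_left, Fin.append_right]
            fin_cases t <;> rfl
        · simp [σ, pairVec, Fin.append_right]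
      rw [hσ, hdec.eval_eq, ofFn_pairVec, List.ofFn_get]
      exact (boolIndicator_eq_of_iff ((hLa (List.ofFn u)).trans (by rw [List.length_ofFn]))).symm
  choose D hD using main
  exact ⟨D, fun n => ⟨(hD n).1, (hD n).2.1, (hD n).2.2.1⟩, fun x => by
    have := (hD x.length).2.2.2 x.get
    rwa [List.ofFn_get] at this⟩

/-- `AC⁰[m]` circuit families (`0 < m`, any depth bound) with at most `S n` gates are `B₂`
circuit families with at most `1 + S n · accGateCost m (n + S n)` gates
(`Circuit.exists_B2_of_accBasis`: every unbounded fan-in gate over the `n + S n` wires is a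
bounded fan-in circuit of size linear in `n + S n`; Vollmer 1999, §1.2).
[cite: Vollmer1999, §1.2] -/
theorem mem_SIZE_of_mem_depthSizeClass_accBasis {m : ℕ} (hm : 0 < m) {dp S : ℕ → ℕ}
    {L : Language Bool} (hL : L ∈ DepthSizeClass (accBasis m) dp S) :
    L ∈ SIZE (fun n => 1 + S n * accGateCost m (n + S n)) := by
  obtain ⟨C, hC, hdec⟩ := hL
  have main : ∀ n, ∃ D : Circuit (Fin n), D.IsOver B2 ∧
      D.size ≤ 1 + S n * accGateCost m (n + S n) ∧ ∀ x, D.eval x = (C n).eval x := by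
    intro n
    obtain ⟨D, hD, hs, he⟩ := (C n).exists_B2_of_accBasis hm (hC n).1
    refine ⟨D, hD, hs.trans ?_, he⟩
    have h1 : (C n).size ≤ S n := (hC n).2.2
    exact Nat.add_le_add_left
      (Nat.mul_le_mul h1 (accGateCost_mono m (Nat.add_le_add_left h1 n))) 1
  choose D hD using main
  exact ⟨D, fun n => ⟨(hD n).1, (hD n).2.1⟩, fun x => by rw [(hD x.length).2.2]; exact hdec x⟩

/-! ### Growth bookkeeping: quasi-polynomial of level `j`

A function `f : ℕ → ℕ` is *quasi-polynomially bounded of level `j`* if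
`f n ≤ 2^{a · (log₂ n + 2)ʲ}` for some constant `a` and all `n` (`log₂ = Nat.log 2`; the shift
`+ 2` keeps the base of the power `≥ 2`, so that no case distinction at `n ≤ 1` is needed). The
levels of the tree's idioms `c · 2^{(log₂ n)ᵏ} + c` and `c · n^{(log₂ n)ᵏ} + c` are `k` and
`k + 1`, and conversely level `j` is `≤ c · 2^{(log₂ n)^{j+1}} + c`
(`qpoly_exists_le_two_pow_log_pow`). The bookkeeping is kept as plain `∃ a, ∀ n, …`
statements (in the style of `IsExpBounded`, `GrowthBounds.lean`, without introducing a
predicate). -/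

section QPoly

variable {j : ℕ} {f g : ℕ → ℕ}

/-- Constants are quasi-polynomially bounded of every level. [folklore] -/
theorem qpoly_const (C j : ℕ) : ∃ a : ℕ, ∀ n : ℕ, C ≤ 2 ^ (a * (Nat.log 2 n + 2) ^ j) := by
  refine ⟨C, fun n => Nat.lt_two_pow_self.le.trans (Nat.pow_le_pow_right two_pos ?_)⟩
  exact Nat.le_mul_of_pos_right C (pow_pos (by omega) j)

/-- The identity is quasi-polynomially bounded of every level `≥ 1` (`n < 2^{log₂ n + 1}`).
[folklore] -/
theorem qpoly_id (hj : 1 ≤ j) : ∃ a : ℕ, ∀ n : ℕ, n ≤ 2 ^ (a * (Nat.log 2 n + 2) ^ j) := by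
  refine ⟨1, fun n => (Nat.lt_pow_succ_log_self one_lt_two n).le.trans
    (Nat.pow_le_pow_right two_pos ?_)⟩
  rw [one_mul]
  calc Nat.log 2 n + 1 ≤ Nat.log 2 n + 2 := Nat.le_succ _
    _ = (Nat.log 2 n + 2) ^ 1 := (pow_one _).symm
    _ ≤ (Nat.log 2 n + 2) ^ j := Nat.pow_le_pow_right (by omega) hj

/-- Closure under addition. [folklore] -/
theorem qpoly_add (hf : ∃ a : ℕ, ∀ n : ℕ, f n ≤ 2 ^ (a * (Nat.log 2 n + 2) ^ j))
    (hg : ∃ a : ℕ, ∀ n : ℕ, g n ≤ 2 ^ (a * (Nat.log 2 n + 2) ^ j)) :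
    ∃ a : ℕ, ∀ n : ℕ, f n + g n ≤ 2 ^ (a * (Nat.log 2 n + 2) ^ j) := by
  obtain ⟨a, ha⟩ := hf
  obtain ⟨b, hb⟩ := hg
  refine ⟨a + b + 1, fun n => ?_⟩
  set P := (Nat.log 2 n + 2) ^ j
  have hP : 1 ≤ P := Nat.one_le_pow _ _ (by omega)
  have h1 : 2 ^ (a * P) ≤ 2 ^ ((a + b) * P) :=
    Nat.pow_le_pow_right two_pos (Nat.mul_le_mul_right P (Nat.le_add_right a b))
  have h2 : 2 ^ (b * P) ≤ 2 ^ ((a + b) * P) :=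
    Nat.pow_le_pow_right two_pos (Nat.mul_le_mul_right P (Nat.le_add_left b a))
  calc f n + g n ≤ 2 ^ ((a + b) * P) + 2 ^ ((a + b) * P) :=
        Nat.add_le_add ((ha n).trans h1) ((hb n).trans h2)
    _ = 2 ^ ((a + b) * P + 1) := by rw [pow_succ]; ring
    _ ≤ 2 ^ ((a + b + 1) * P) := Nat.pow_le_pow_right two_pos (by nlinarith)

/-- Closure under multiplication. [folklore] -/
theorem qpoly_mul (hf : ∃ a : ℕ, ∀ n : ℕ, f n ≤ 2 ^ (a * (Nat.log 2 n + 2) ^ j))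
    (hg : ∃ a : ℕ, ∀ n : ℕ, g n ≤ 2 ^ (a * (Nat.log 2 n + 2) ^ j)) :
    ∃ a : ℕ, ∀ n : ℕ, f n * g n ≤ 2 ^ (a * (Nat.log 2 n + 2) ^ j) := by
  obtain ⟨a, ha⟩ := hf
  obtain ⟨b, hb⟩ := hg
  refine ⟨a + b, fun n => ?_⟩
  calc f n * g n ≤ 2 ^ (a * (Nat.log 2 n + 2) ^ j) * 2 ^ (b * (Nat.log 2 n + 2) ^ j) :=
        Nat.mul_le_mul (ha n) (hb n)
    _ = 2 ^ ((a + b) * (Nat.log 2 n + 2) ^ j) := by rw [← pow_add, add_mul]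

/-- **Post-composition with `N ↦ N^{(log₂ N)ᵏ}`** multiplies the level by `k + 1`: if
`f n ≤ 2^P` then `log₂ (f n) ≤ P` and `(f n)^{(log₂ f n)ᵏ} ≤ 2^{P · Pᵏ}`. [folklore] -/
theorem qpoly_powLog (hf : ∃ a : ℕ, ∀ n : ℕ, f n ≤ 2 ^ (a * (Nat.log 2 n + 2) ^ j)) (k : ℕ) :
    ∃ a : ℕ, ∀ n : ℕ,
      f n ^ Nat.log 2 (f n) ^ k ≤ 2 ^ (a * (Nat.log 2 n + 2) ^ (j * (k + 1))) := by
  obtain ⟨a, ha⟩ := hf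
  refine ⟨a ^ (k + 1), fun n => ?_⟩
  set P := a * (Nat.log 2 n + 2) ^ j with hP
  have h1 : f n ≤ 2 ^ P := ha n
  have h2 : Nat.log 2 (f n) ≤ P :=
    calc Nat.log 2 (f n) ≤ Nat.log 2 (2 ^ P) := Nat.log_mono_right h1
      _ = P := Nat.log_pow one_lt_two P
  calc f n ^ Nat.log 2 (f n) ^ k ≤ (2 ^ P) ^ Nat.log 2 (f n) ^ k := Nat.pow_le_pow_left h1 _
    _ ≤ (2 ^ P) ^ P ^ k := Nat.pow_le_pow_right (Nat.two_pow_pos P) (Nat.pow_le_pow_left h2 k)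
    _ = 2 ^ (P ^ (k + 1)) := by rw [← pow_mul, ← pow_succ']
    _ = 2 ^ (a ^ (k + 1) * (Nat.log 2 n + 2) ^ (j * (k + 1))) := by rw [hP, mul_pow, ← pow_mul]

/-- The idiom `n^{(log₂ n)ᵏ}` is quasi-polynomially bounded of level `k + 1`. [folklore] -/
theorem qpoly_pow_log_pow (k : ℕ) :
    ∃ a : ℕ, ∀ n : ℕ, n ^ Nat.log 2 n ^ k ≤ 2 ^ (a * (Nat.log 2 n + 2) ^ (k + 1)) := by
  have h := qpoly_powLog (qpoly_id (le_refl 1)) k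
  rwa [one_mul] at h

/-- **Back to the tree's idiom**: a function of level `j` is `≤ c · 2^{(log₂ n)^{j+1}} + c` for
some `c` (for `log₂ n ≥ a 2ʲ + 2` one has `a (log₂ n + 2)ʲ ≤ a (2 log₂ n)ʲ ≤ (log₂ n)^{j+1}`; the
finitely many smaller `log₂ n` are absorbed by `c`). [folklore] -/
theorem qpoly_exists_le_two_pow_log_pow
    (hf : ∃ a : ℕ, ∀ n : ℕ, f n ≤ 2 ^ (a * (Nat.log 2 n + 2) ^ j)) :
    ∃ c : ℕ, ∀ n : ℕ, f n ≤ c * 2 ^ Nat.log 2 n ^ (j + 1) + c := by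
  obtain ⟨a, ha⟩ := hf
  set L₀ := a * 2 ^ j + 2 with hL₀
  refine ⟨2 ^ (a * (L₀ + 2) ^ j), fun n => ?_⟩
  set L := Nat.log 2 n
  set c := 2 ^ (a * (L₀ + 2) ^ j)
  have hc : 1 ≤ c := Nat.one_le_two_pow
  rcases le_or_gt L L₀ with hL | hL
  · calc f n ≤ 2 ^ (a * (L + 2) ^ j) := ha n
      _ ≤ c := Nat.pow_le_pow_right two_pos
          (Nat.mul_le_mul_left a (Nat.pow_le_pow_left (Nat.add_le_add_right hL 2) j))
      _ ≤ c * 2 ^ L ^ (j + 1) + c := Nat.le_add_left _ _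
  · have h2L : L + 2 ≤ 2 * L := by omega
    have haL : a * 2 ^ j ≤ L := by omega
    have hexp : a * (L + 2) ^ j ≤ L ^ (j + 1) :=
      calc a * (L + 2) ^ j ≤ a * (2 * L) ^ j := Nat.mul_le_mul_left a (Nat.pow_le_pow_left h2L j)
        _ = (a * 2 ^ j) * L ^ j := by rw [mul_pow]; ring
        _ ≤ L * L ^ j := Nat.mul_le_mul_right _ haL
        _ = L ^ (j + 1) := (pow_succ' L j).symm
    calc f n ≤ 2 ^ (a * (L + 2) ^ j) := ha n
      _ ≤ 2 ^ L ^ (j + 1) := Nat.pow_le_pow_right two_pos hexp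
      _ ≤ c * 2 ^ L ^ (j + 1) := Nat.le_mul_of_pos_left _ hc
      _ ≤ _ := Nat.le_add_right _ _

end QPoly

/-- `N ↦ N^{(log₂ N)ᵏ}` is monotone. [folklore] -/
theorem pow_log_pow_mono (k : ℕ) : Monotone fun n : ℕ => n ^ Nat.log 2 n ^ k := by
  intro x y hxy
  dsimp only
  rcases Nat.eq_zero_or_pos x with rfl | hx
  · rcases Nat.eq_zero_or_pos y with rfl | hy
    · exact le_rfl
    · calc (0 : ℕ) ^ Nat.log 2 0 ^ k ≤ 1 := by
            rcases Nat.eq_zero_or_pos (Nat.log 2 0 ^ k) with h0 | hpos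
            · rw [h0, pow_zero]
            · rw [zero_pow hpos.ne']; exact Nat.zero_le _
        _ ≤ y ^ Nat.log 2 y ^ k := Nat.one_le_pow _ _ hy
  · have hy : 0 < y := lt_of_lt_of_le hx hxy
    calc x ^ Nat.log 2 x ^ k ≤ y ^ Nat.log 2 x ^ k := Nat.pow_le_pow_left hxy _
      _ ≤ y ^ Nat.log 2 y ^ k :=
          Nat.pow_le_pow_right hy (Nat.pow_le_pow_left (Nat.log_mono_right hxy) k)

/-! ### Pinning at level `k` -/

/-- **Level-`k` pinning**: for every `k` there is a level `K` (namely `(k + 1)² + 1`) such that,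
whenever `EvalLang` has depth-`d₀` `AC⁰[m₀]` circuit families of size
`c₀ · n^{(log₂ n)ᵏ} + c₀`, every language with `AC⁰[m]` circuit families (any modulus `m ≥ 1`,
any depth bound) of size `c · n^{(log₂ n)ᵏ} + c` has depth-`(d₀ + 1)` `AC⁰[m₀]` circuit families
of size `c' · 2^{(log₂ n)ᴷ} + c'` for some `c'` (Williams 2014, Lemma 5.1, at quasi-polynomial
`S`, `T`: the `AC⁰[m]` circuits are `B₂` circuits of quasi-polynomial size,
`mem_SIZE_of_mem_depthSizeClass_accBasis`, whose descriptions are hard-wired into the circuits of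
`EvalLang`, `mem_depthSizeClass_of_evalLang_mem`; the bookkeeping is `qpoly_*`).
[cite: Williams2014, Lemma 5.1] -/
theorem exists_level_pinned (k : ℕ) : ∃ K : ℕ, ∀ {m₀ d₀ c₀ : ℕ},
    EvalLang ∈ DepthSizeClass (accBasis m₀) (fun _ => d₀)
      (fun n => c₀ * n ^ Nat.log 2 n ^ k + c₀) →
    ∀ {L : Language Bool} {m c : ℕ} {dp : ℕ → ℕ}, 0 < m →
      L ∈ DepthSizeClass (accBasis m) dp (fun n => c * n ^ Nat.log 2 n ^ k + c) →
        ∃ c' : ℕ, L ∈ DepthSizeClass (accBasis m₀) (fun _ => d₀ + 1)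
          (fun n => c' * 2 ^ Nat.log 2 n ^ K + c') := by
  refine ⟨(k + 1) * (k + 1) + 1, ?_⟩
  intro m₀ d₀ c₀ hE L m c dp hm hL
  -- the data: `B₂` size `s`, description length, pinned size `f`
  set S : ℕ → ℕ := fun n => c * n ^ Nat.log 2 n ^ k + c with hS
  set s : ℕ → ℕ := fun n => 1 + S n * accGateCost m (n + S n) with hs
  set q : ℕ → ℕ := fun N => c₀ * N ^ Nat.log 2 N ^ k + c₀ with hq_def
  have hq : Monotone q := fun x y hxy =>
    Nat.add_le_add_right (Nat.mul_le_mul_left c₀ (pow_log_pow_mono k hxy)) c₀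
  have hSIZE : L ∈ SIZE s := mem_SIZE_of_mem_depthSizeClass_accBasis hm hL
  have hpin := mem_depthSizeClass_of_evalLang_mem hq hE hSIZE
  -- growth bookkeeping at level `k + 1`, then `(k + 1)²`
  have hSq : ∃ a : ℕ, ∀ n : ℕ, S n ≤ 2 ^ (a * (Nat.log 2 n + 2) ^ (k + 1)) :=
    qpoly_add (qpoly_mul (qpoly_const c _) (qpoly_pow_log_pow k)) (qpoly_const c _)
  have hid : ∃ a : ℕ, ∀ n : ℕ, n ≤ 2 ^ (a * (Nat.log 2 n + 2) ^ (k + 1)) :=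
    qpoly_id (Nat.le_add_left 1 k)
  have hnS : ∃ a : ℕ, ∀ n : ℕ, n + S n ≤ 2 ^ (a * (Nat.log 2 n + 2) ^ (k + 1)) :=
    qpoly_add hid hSq
  have hcost : ∃ a : ℕ, ∀ n : ℕ,
      accGateCost m (n + S n) ≤ 2 ^ (a * (Nat.log 2 n + 2) ^ (k + 1)) := by
    change ∃ a : ℕ, ∀ n : ℕ, (4 * m + 1) * (n + S n) + m + 2 ≤ 2 ^ (a * (Nat.log 2 n + 2) ^ (k + 1))
    exact qpoly_add (qpoly_add (qpoly_mul (qpoly_const _ _) hnS) (qpoly_const _ _))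
      (qpoly_const _ _)
  have hsq : ∃ a : ℕ, ∀ n : ℕ, s n ≤ 2 ^ (a * (Nat.log 2 n + 2) ^ (k + 1)) :=
    qpoly_add (qpoly_const 1 _) (qpoly_mul hSq hcost)
  have hN : ∃ a : ℕ, ∀ n : ℕ,
      2 * n + 2 + (s n + 1) * (8 * (n + s n) + 10) ≤ 2 ^ (a * (Nat.log 2 n + 2) ^ (k + 1)) :=
    qpoly_add (qpoly_add (qpoly_mul (qpoly_const 2 _) hid) (qpoly_const 2 _))
      (qpoly_mul (qpoly_add hsq (qpoly_const 1 _))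
        (qpoly_add (qpoly_mul (qpoly_const 8 _) (qpoly_add hid hsq)) (qpoly_const 10 _)))
  have hqN : ∃ a : ℕ, ∀ n : ℕ, q (2 * n + 2 + (s n + 1) * (8 * (n + s n) + 10)) + 2 ≤
      2 ^ (a * (Nat.log 2 n + 2) ^ ((k + 1) * (k + 1))) :=
    qpoly_add (qpoly_add (qpoly_mul (qpoly_const c₀ _) (qpoly_powLog hN k)) (qpoly_const c₀ _))
      (qpoly_const 2 _)
  obtain ⟨c', hc'⟩ := qpoly_exists_le_two_pow_log_pow hqN
  exact ⟨c', DepthSizeClass_mono le_rfl (fun _ => le_rfl) hc' hpin⟩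

/-! ### The §1.1 form from Theorem 1.2, Theorem 5.1 and the glue fact -/

/-- **`MurrayWilliams2018_NQP_not_ACC` from its printed components** (Murray–Williams 2018, §1.1
"`NQP` does not have `ACC ∘ THR` circuits of `n^{logᵏ n}` size, for all fixed `k`", by the proof
of Thm. 1.3 on p. 15 together with the pinning of Williams 2014, Lemma 5.1 / the EVAL-GATE step
of §5): the connection Thm. 1.2 for `AC⁰[m]` (`MurrayWilliams2018_thm_1_2_acc`), the `ACC`-SAT
algorithm Thm. 5.1 (`MurrayWilliams2018_thm_5_1`) and the folklore inclusion
`NTIME(n^{(log₂ n)ᵉ}) ⊆ NQP` (`NTIME_powLog_subset_NQP`) imply that for every `k` some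
`L ∈ NQP` has, for no `d`, `m ≥ 2`, `c`, depth-`d` `AC⁰[m]` circuit families of size
`c · n^{(log₂ n)ᵏ} + c`. Proof: otherwise `EvalLang ∈ P ⊆ NQP` (`P_subset_NQP`) has such circuits
for one `(d₀, m₀)`; by `exists_level_pinned` every `NQP` language then has depth-`(d₀ + 1)`
`AC⁰[m₀]` circuits of size `c' · 2^{(log₂ n)ᴷ} + c'`; but Thm. 1.2 at `(d₀ + 1, m₀, K)`, fed with
the algorithms of Thm. 5.1 over `m₀`, yields a language in `NTIME(n^{(log₂ n)ᵉ}) ⊆ NQP` without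
them. [cite: MurrayWilliams2018, §1.1 and Thm. 1.3] -/
theorem MurrayWilliams2018_NQP_not_ACC_of_components (h12 : MurrayWilliams2018_thm_1_2_acc)
    (h51 : MurrayWilliams2018_thm_5_1) (hG : NTIME_powLog_subset_NQP) :
    MurrayWilliams2018_NQP_not_ACC := by
  intro k
  by_contra hcon
  push Not at hcon
  obtain ⟨K, hK⟩ := exists_level_pinned k
  obtain ⟨d₀, m₀, c₀, hm₀, hE⟩ := hcon EvalLang (P_subset_NQP EvalLang_mem_P)
  obtain ⟨e, -, L, hL, hnot⟩ := h12 (d₀ + 1) m₀ hm₀ (fun d' => h51 d' m₀ hm₀) K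
  obtain ⟨d, m, c, hm, hLc⟩ := hcon L (hG e hL)
  obtain ⟨c', hc'⟩ := hK hE (lt_of_lt_of_le two_pos hm) hLc
  exact hnot c' hc'

/-! ### The §1.1 form from Theorem 1.2 and Theorem 5.1 alone -/

/-- **`MurrayWilliams2018_NQP_not_ACC` from Thm. 1.2 and Thm. 5.1** (Murray–Williams 2018, §1.1
and the proof of Thm. 1.3 on p. 15: "to conclude lower bounds such as `NQP ⊄ ACC ∘ THR`
(Theorem 1.3), we only have to appeal to the `ACC ∘ THR`-SAT algorithm: Theorem 5.1"). The glue
hypothesis `NTIME_powLog_subset_NQP` of `MurrayWilliams2018_NQP_not_ACC_of_components` —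
`NTIME (n ^ (log₂ n) ^ e) ⊆ NQP` for every `e`, i.e. that the hard languages of Thm. 1.2/1.3 lie
in `NQP = ⋃ₖ NTIME (2 ^ (log₂ n) ^ k)` — is the theorem `NTIME_pow_log_pow_subset_NQP` of
`QuasiPolyClock.lean` (monotonicity of the tree's verifier-form `NTIME` along the
quasi-polynomial witness clock), so the §1.1 form rests on the two printed theorems alone.
[cite: MurrayWilliams2018, §1.1 and Thm. 1.3] -/
theorem MurrayWilliams2018_NQP_not_ACC_of_thm_1_2_acc (h12 : MurrayWilliams2018_thm_1_2_acc)
    (h51 : MurrayWilliams2018_thm_5_1) : MurrayWilliams2018_NQP_not_ACC :=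
  MurrayWilliams2018_NQP_not_ACC_of_components h12 h51 NTIME_pow_log_pow_subset_NQP

/-- **The headline `¬ (NQP ⊆ ACC0)` from Thm. 1.2 and Thm. 5.1 alone**
(`MurrayWilliams2018_NQP_not_subset_ACC0`, via `MurrayWilliams2018_NQP_not_ACC.not_subset_ACC0`
of `CircuitLowerBounds.lean`). [cite: MurrayWilliams2018, §1.1] -/
theorem MurrayWilliams2018_NQP_not_subset_ACC0_of_thm_1_2_acc
    (h12 : MurrayWilliams2018_thm_1_2_acc) (h51 : MurrayWilliams2018_thm_5_1) :
    MurrayWilliams2018_NQP_not_subset_ACC0 :=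
  (MurrayWilliams2018_NQP_not_ACC_of_thm_1_2_acc h12 h51).not_subset_ACC0

end Literature.Computability.Complexity
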